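import Summits.ValiantsHypothesis.ValiantsHypothesis.Theorems.LacunarySymmetroidMatrixDescartesCensusDoorA34ThreeNodeLaw

/-!
# `MatrixDescartes` census — DOOR A at `(3,4)`: `DoorA34` ⟸ three LINEAR-FAMILY laws (rungs 3, 3′ and 2ᶜ of the node ladder)

HONEST FRAMING.  Object-search cell `pub-symmetroid`, door-A seat `val-sym-door-p3` (g26); item stmt-ValiantsHypothesis-19980
`DoorA34 = PosRootLawAt 3 4 18` (route item `Theses.LacunarySymmetroid.DoorA34`) is OPEN and asserted nowhere in this file.  A REDUCTION,
completing `…ThreeNodeLaw` (which handles the R4 and R2 thirds of `…NodeRows.doorA34_iff_nodeRows`) on the R0 third: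

* `R0_rows_of_conjPairRows` — on a support `d`, the CONJUGATE-PAIR ROWS
  `Z₊( C(M₀,M₁) + Q₁(M₀,M₁)·M₂ + Q₂(M₀,M₁)·M₃ + L(M₀,M₁)·(M₂² + M₃²) ) ≤ 18`
  for all `4`-nomials `M₀,…,M₃` on `d` and all real binary forms `C` (cubic), `Q₁, Q₂` (quadratic), `L` (linear) — the LINEAR family of cubic
  forms singular at the complex-conjugate pair of vertices `(0 : 0 : 1 : ±i)` (partial degree `≤ 1` in `y₂ ± i y₃`; rung 2ᶜ of the ladder,
  dimension `12`) — IMPLY the R0 row family on `d` (the R0 row `r(p²+q²) + p(r²+s²)` is the member `C = 0, Q₁ = y₀²+y₁², Q₂ = 0, L = y₀` with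
  `(M₀,M₁,M₂,M₃) = (p,q,r,s)`);
* `doorA34_of_linearFamilyLaws` — all supports: THREE-NODE LAW (rung 3) ∧ MIXED THREE-NODE LAW (rung 3′) ∧ CONJUGATE-PAIR LAW (rung 2ᶜ)
  ⟹ `DoorA34`; support form `posRootLawOn_of_linearFamilyRows`.

STATUS (honest): all three hypotheses are OPEN ∀-laws on `20`-nomial LINEAR families with Descartes ceiling `19`, located nowhere; the
conjugate-pair family is LARGE (rung 2ᶜ: it even contains the rung-one objects' analogues in codimension) and may well reach `19` — then this
reduction is idle for R0 and the R0 third needs the rotation structure of `…NodeTwins` instead.  Nothing here bounds `ζ_sym(3,4)`; `DoorA34`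
stays OPEN; registers unchanged; nothing on `MatrixDescartes` (stmt-ValiantsHypothesis-18050) or on `VP ≠ VNP`.  [folklore] `ring` + the tree's
node-row equivalence.
-/

-- `Summit.ValiantsHypothesis.ValiantsHypothesis.…` repeats a component by the D-0017 layout
-- (single-conjunct summit), which the `dupNamespace` linter flags; the name is mandated.
set_option linter.dupNamespace false

namespace Summit.ValiantsHypothesis.ValiantsHypothesis.Theorems.LacunarySymmetroidMatrixDescartes.Census.ThreeNodeLaw

open Polynomial Finset
open scoped BigOperators
open Summit.ValiantsHypothesis.ValiantsHypothesis.Theorems.MatrixDescartes.Negative (PosRootLawAt)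
open Summit.ValiantsHypothesis.ValiantsHypothesis.Theorems.LacunarySymmetroidMatrixDescartes.Census.EqualDiagonal
  (posRootLawOn_iff_nodeRows doorA34_iff_nodeRows)

variable (d : Fin 4 → ℕ)

/-- **CONJUGATE-PAIR ROWS ⟹ R0 ROWS** on a support `d`.  If every member of the linear family of cubic forms singular at the conjugate pair
`(0:0:1:±i)` — `C(M₀,M₁) + Q₁(M₀,M₁)M₂ + Q₂(M₀,M₁)M₃ + L(M₀,M₁)(M₂²+M₃²)` with real binary forms `C` (coefficients `c`), `Q₁` (`a`), `Q₂` (`b`),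
`L` (`l`) — composed with four `4`-nomials on `d` has `≤ 18` distinct positive roots, then so does every R0 node row
`N(r)(N(p)²+N(q)²) + N(p)(N(r)²+N(s)²)` (the member `c = 0`, `a = (1,0,1)`, `b = 0`, `l = (1,0)` at `(M₀,M₁,M₂,M₃) = (p,q,r,s)`). [folklore] -/
theorem R0_rows_of_conjPairRows
    (h2c : ∀ (M₀ M₁ M₂ M₃ : Fin 4 → ℝ) (c₀ c₁ c₂ c₃ a₀ a₁ a₂ b₀ b₁ b₂ l₀ l₁ : ℝ),
      (((C c₀ * (∑ l, C (M₀ l) * (X : ℝ[X]) ^ d l) ^ 3 + C c₁ * (∑ l, C (M₀ l) * X ^ d l) ^ 2 * (∑ l, C (M₁ l) * X ^ d l)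
            + C c₂ * (∑ l, C (M₀ l) * X ^ d l) * (∑ l, C (M₁ l) * X ^ d l) ^ 2 + C c₃ * (∑ l, C (M₁ l) * X ^ d l) ^ 3)
          + (C a₀ * (∑ l, C (M₀ l) * X ^ d l) ^ 2 + C a₁ * (∑ l, C (M₀ l) * X ^ d l) * (∑ l, C (M₁ l) * X ^ d l)
              + C a₂ * (∑ l, C (M₁ l) * X ^ d l) ^ 2) * (∑ l, C (M₂ l) * X ^ d l)
          + (C b₀ * (∑ l, C (M₀ l) * X ^ d l) ^ 2 + C b₁ * (∑ l, C (M₀ l) * X ^ d l) * (∑ l, C (M₁ l) * X ^ d l)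
              + C b₂ * (∑ l, C (M₁ l) * X ^ d l) ^ 2) * (∑ l, C (M₃ l) * X ^ d l)
          + (C l₀ * (∑ l, C (M₀ l) * X ^ d l) + C l₁ * (∑ l, C (M₁ l) * X ^ d l))
              * ((∑ l, C (M₂ l) * X ^ d l) ^ 2 + (∑ l, C (M₃ l) * X ^ d l) ^ 2)).roots.toFinset.filter (fun t => 0 < t)).card ≤ 18)
    (p q r s : Fin 4 → ℝ) :
    (((∑ l, C (r l) * (X : ℝ[X]) ^ d l) * ((∑ l, C (p l) * X ^ d l) ^ 2 + (∑ l, C (q l) * X ^ d l) ^ 2)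
        + (∑ l, C (p l) * X ^ d l) * ((∑ l, C (r l) * X ^ d l) ^ 2 + (∑ l, C (s l) * X ^ d l) ^ 2)).roots.toFinset.filter
      (fun t => 0 < t)).card ≤ 18 := by
  have key : (∑ l, C (r l) * (X : ℝ[X]) ^ d l) * ((∑ l, C (p l) * X ^ d l) ^ 2 + (∑ l, C (q l) * X ^ d l) ^ 2)
        + (∑ l, C (p l) * X ^ d l) * ((∑ l, C (r l) * X ^ d l) ^ 2 + (∑ l, C (s l) * X ^ d l) ^ 2)
      = (C 0 * (∑ l, C (p l) * (X : ℝ[X]) ^ d l) ^ 3 + C 0 * (∑ l, C (p l) * X ^ d l) ^ 2 * (∑ l, C (q l) * X ^ d l)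
            + C 0 * (∑ l, C (p l) * X ^ d l) * (∑ l, C (q l) * X ^ d l) ^ 2 + C 0 * (∑ l, C (q l) * X ^ d l) ^ 3)
          + (C 1 * (∑ l, C (p l) * X ^ d l) ^ 2 + C 0 * (∑ l, C (p l) * X ^ d l) * (∑ l, C (q l) * X ^ d l)
              + C 1 * (∑ l, C (q l) * X ^ d l) ^ 2) * (∑ l, C (r l) * X ^ d l)
          + (C 0 * (∑ l, C (p l) * X ^ d l) ^ 2 + C 0 * (∑ l, C (p l) * X ^ d l) * (∑ l, C (q l) * X ^ d l)
              + C 0 * (∑ l, C (q l) * X ^ d l) ^ 2) * (∑ l, C (s l) * X ^ d l)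
          + (C 1 * (∑ l, C (p l) * X ^ d l) + C 0 * (∑ l, C (q l) * X ^ d l))
              * ((∑ l, C (r l) * X ^ d l) ^ 2 + (∑ l, C (s l) * X ^ d l) ^ 2) := by
    simp only [map_zero, map_one, zero_mul, zero_add, add_zero, one_mul]
    ring
  rw [key]
  exact h2c p q r s 0 0 0 0 1 0 1 0 0 0 1 0

/-- **`ζ(3,4; d) ≤ 18` ⟸ the three linear-family rows on `d`** (three-node, mixed three-node, conjugate-pair). [folklore] -/
theorem posRootLawOn_of_linearFamilyRows
    (h3 : ∀ L₀ L₁ L₂ L₃ lam : Fin 4 → ℝ,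
      (((∑ l, C (L₁ l) * (X : ℝ[X]) ^ d l) * (∑ l, C (L₂ l) * X ^ d l) * (∑ l, C (L₃ l) * X ^ d l)
          - (∑ l, C (L₀ l) * X ^ d l) ^ 2 * (∑ l, C (lam l) * X ^ d l)).roots.toFinset.filter (fun t => 0 < t)).card ≤ 18)
    (h3c : ∀ L₀ L₁ A B lam : Fin 4 → ℝ,
      (((∑ l, C (L₁ l) * (X : ℝ[X]) ^ d l) * ((∑ l, C (A l) * X ^ d l) ^ 2 + (∑ l, C (B l) * X ^ d l) ^ 2)
          - (∑ l, C (L₀ l) * X ^ d l) ^ 2 * (∑ l, C (lam l) * X ^ d l)).roots.toFinset.filter (fun t => 0 < t)).card ≤ 18)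
    (h2c : ∀ (M₀ M₁ M₂ M₃ : Fin 4 → ℝ) (c₀ c₁ c₂ c₃ a₀ a₁ a₂ b₀ b₁ b₂ l₀ l₁ : ℝ),
      (((C c₀ * (∑ l, C (M₀ l) * (X : ℝ[X]) ^ d l) ^ 3 + C c₁ * (∑ l, C (M₀ l) * X ^ d l) ^ 2 * (∑ l, C (M₁ l) * X ^ d l)
            + C c₂ * (∑ l, C (M₀ l) * X ^ d l) * (∑ l, C (M₁ l) * X ^ d l) ^ 2 + C c₃ * (∑ l, C (M₁ l) * X ^ d l) ^ 3)
          + (C a₀ * (∑ l, C (M₀ l) * X ^ d l) ^ 2 + C a₁ * (∑ l, C (M₀ l) * X ^ d l) * (∑ l, C (M₁ l) * X ^ d l)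
              + C a₂ * (∑ l, C (M₁ l) * X ^ d l) ^ 2) * (∑ l, C (M₂ l) * X ^ d l)
          + (C b₀ * (∑ l, C (M₀ l) * X ^ d l) ^ 2 + C b₁ * (∑ l, C (M₀ l) * X ^ d l) * (∑ l, C (M₁ l) * X ^ d l)
              + C b₂ * (∑ l, C (M₁ l) * X ^ d l) ^ 2) * (∑ l, C (M₃ l) * X ^ d l)
          + (C l₀ * (∑ l, C (M₀ l) * X ^ d l) + C l₁ * (∑ l, C (M₁ l) * X ^ d l))
              * ((∑ l, C (M₂ l) * X ^ d l) ^ 2 + (∑ l, C (M₃ l) * X ^ d l) ^ 2)).roots.toFinset.filter (fun t => 0 < t)).card ≤ 18) :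
    PosRootLawOn 3 4 18 d :=
  posRootLawOn_of_threeNodeRows d h3 h3c (R0_rows_of_conjPairRows d h2c)

/-- **`DoorA34` ⟸ THREE LINEAR-FAMILY LAWS (all supports)**: the three-node law (rung 3), the mixed three-node law (rung 3′) and the
conjugate-pair law (rung 2ᶜ) together imply the cell's target `DoorA34` (= the route item by `Iff.rfl`).  All three are OPEN. [folklore] -/
theorem doorA34_of_linearFamilyLaws
    (h3 : ∀ (d : Fin 4 → ℕ) (L₀ L₁ L₂ L₃ lam : Fin 4 → ℝ),
      (((∑ l, C (L₁ l) * (X : ℝ[X]) ^ d l) * (∑ l, C (L₂ l) * X ^ d l) * (∑ l, C (L₃ l) * X ^ d l)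
          - (∑ l, C (L₀ l) * X ^ d l) ^ 2 * (∑ l, C (lam l) * X ^ d l)).roots.toFinset.filter (fun t => 0 < t)).card ≤ 18)
    (h3c : ∀ (d : Fin 4 → ℕ) (L₀ L₁ A B lam : Fin 4 → ℝ),
      (((∑ l, C (L₁ l) * (X : ℝ[X]) ^ d l) * ((∑ l, C (A l) * X ^ d l) ^ 2 + (∑ l, C (B l) * X ^ d l) ^ 2)
          - (∑ l, C (L₀ l) * X ^ d l) ^ 2 * (∑ l, C (lam l) * X ^ d l)).roots.toFinset.filter (fun t => 0 < t)).card ≤ 18)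
    (h2c : ∀ (d : Fin 4 → ℕ) (M₀ M₁ M₂ M₃ : Fin 4 → ℝ) (c₀ c₁ c₂ c₃ a₀ a₁ a₂ b₀ b₁ b₂ l₀ l₁ : ℝ),
      (((C c₀ * (∑ l, C (M₀ l) * (X : ℝ[X]) ^ d l) ^ 3 + C c₁ * (∑ l, C (M₀ l) * X ^ d l) ^ 2 * (∑ l, C (M₁ l) * X ^ d l)
            + C c₂ * (∑ l, C (M₀ l) * X ^ d l) * (∑ l, C (M₁ l) * X ^ d l) ^ 2 + C c₃ * (∑ l, C (M₁ l) * X ^ d l) ^ 3)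
          + (C a₀ * (∑ l, C (M₀ l) * X ^ d l) ^ 2 + C a₁ * (∑ l, C (M₀ l) * X ^ d l) * (∑ l, C (M₁ l) * X ^ d l)
              + C a₂ * (∑ l, C (M₁ l) * X ^ d l) ^ 2) * (∑ l, C (M₂ l) * X ^ d l)
          + (C b₀ * (∑ l, C (M₀ l) * X ^ d l) ^ 2 + C b₁ * (∑ l, C (M₀ l) * X ^ d l) * (∑ l, C (M₁ l) * X ^ d l)
              + C b₂ * (∑ l, C (M₁ l) * X ^ d l) ^ 2) * (∑ l, C (M₃ l) * X ^ d l)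
          + (C l₀ * (∑ l, C (M₀ l) * X ^ d l) + C l₁ * (∑ l, C (M₁ l) * X ^ d l))
              * ((∑ l, C (M₂ l) * X ^ d l) ^ 2 + (∑ l, C (M₃ l) * X ^ d l) ^ 2)).roots.toFinset.filter (fun t => 0 < t)).card ≤ 18) :
    DoorA34 :=
  doorA34_iff_nodeRows.mpr
    ⟨fun d => R4_rows_of_threeNodeRows d (h3 d), fun d p q ℓ => R2_rows_of_threeNodeRowsC d (h3c d) p q ℓ,
      fun d => R0_rows_of_conjPairRows d (h2c d)⟩

end Summit.ValiantsHypothesis.ValiantsHypothesis.Theorems.LacunarySymmetroidMatrixDescartes.Census.ThreeNodeLaw
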